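import Literature.NumberTheory.EllipticCurves.SelmerCorankProofs
import HarnessLib

/-!
# `p`-primary algebra for the strict-Selmer index: divisibility levels modulo torsion, `#(ℚ_p/ℤ_p)[p^m] = p^m`,
# and the «uniserial» lemma (theorems only — no definition, no named fact; nothing about any curve's BSD)

HONEST FRAMING (cell `b2b-bsdres`, run/shared/lean/b2b/bsd-rank1-residual/, verbatim in every
file): the goal of the cell is to DELETE the COMBINATION-SHAPED residual classes of the
Birch–Swinnerton-Dyer formula for ALL analytic-rank `≤ 1` elliptic curves over `ℚ` — "full BSD
formula for every rank `≤ 1` curve in class `C`" assembled STRICTLY from published theorems — so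
that the rank-`≤ 1` remainder becomes exactly the CONSTRUCTION-SHAPED classes, which are TYPED
(missing-input `Prop`s), NOT attempted. This is not "finishing BSD". Seat `b2b-bsdres-additive-p3`
(X8 prover B / X7 joint; typer-designate for the cell conjecture C-16 = hyp C120.1 by hyp R-16 (e)).
This file books nothing and moves no mark; X7 / X8 stay CONSTRUCTION-SHAPED.

## What this file does

Pure algebra used by `Ordinary/KummerLineLocalTriviality.lean` and `Ordinary/StrictSelmerIndexRankOne.lean`
(the strict `p`-Selmer group in rank one, R1-DEPTH-LAW §2 (i)):
* `exists_eq_pow_smul_add_torsion_nsmul_iff` / `_zsmul_iff`: in any additive commutative group, if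
  `x ∈ p^m G + G_tors` and `x ∉ p^(m+1) G + G_tors` then `a • x ∈ p^N G + G_tors ⟺ p^(N-m) ∣ a` (the
  divisibility LEVEL of `x` modulo torsion governs all its multiples; `⟹` by division up to torsion and
  Bézout);
* `zsmul_prufGen_eq_zero_iff` (`b • e_N = 0 ⟺ p^N ∣ b` in `ℚ_p/ℤ_p`, tree `PruferQuot` / `prufGen` of
  `SelmerCorankProofs`) and `natCard_torsionBy_pruferQuot_pow` (`#(ℚ_p/ℤ_p)[p^m] = p^m`);
* `eq_top_of_divisible_of_card_torsion_le`: a `p`-primary abelian group with at most `p` elements killed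
  by `p` has no proper non-zero `p`-divisible subgroup;
* small helpers `isOfFinAddOrder_of_zsmul`, `pow_dvd_pow_mul_iff_pow_sub_dvd`.

References: folklore (Silverman AEC VIII.§2 for the use); `R1-DEPTH-LAW.md` §2 (i).
-/

noncomputable section

open scoped Classical
open scoped AddSubgroup

open Literature.NumberTheory.EllipticCurves

namespace Summit.BirchSwinnertonDyer.Rank1Residual.Ordinary

/-! ### §1 Divisibility levels modulo torsion -/

section DivisibilityLevel

variable {G : Type*} [AddCommGroup G]

/-- If `k • y` has finite order and `k ≠ 0` then `y` has finite order. [folklore] -/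
theorem isOfFinAddOrder_of_nsmul {k : ℕ} (hk : k ≠ 0) {y : G} (h : IsOfFinAddOrder (k • y)) :
    IsOfFinAddOrder y :=
  IsOfFinAddOrder.of_nsmul h hk

/-- **The divisibility level of a point modulo torsion governs all its multiples (natural
multipliers).** If `x = p^m • R + T` with `T` of finite order but `x` is NOT of the form
`p^(m+1) • R + T`, then for every `N` and `n : ℕ`, `n • x ∈ p^N • G + G_tors ⟺ p^(N-m) ∣ n`.
(`⟸`: multiply out; `⟹`: write `n = p^s c` with `p ∤ c`; if `s < N - m` then `c • x ∈ p^(N-s) G + G_tors`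
(division by `p^s` up to torsion) and Bézout for `(c, p^(N-s)) = 1` puts `x` in `p^(N-s) G + G_tors` with
`N - s ≥ m + 1`, a contradiction.) [folklore] -/
theorem exists_eq_pow_smul_add_torsion_nsmul_iff {p : ℕ} (hp : p.Prime) {x : G} {m : ℕ}
    (hm : ∃ R T : G, IsOfFinAddOrder T ∧ x = p ^ m • R + T)
    (hm1 : ¬ ∃ R T : G, IsOfFinAddOrder T ∧ x = p ^ (m + 1) • R + T) (N n : ℕ) :
    (∃ R T : G, IsOfFinAddOrder T ∧ n • x = p ^ N • R + T) ↔ p ^ (N - m) ∣ n := by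
  obtain ⟨R₀, T₀, hT₀, hx⟩ := hm
  constructor
  · rintro ⟨R, T, hT, hn⟩
    by_contra hnd
    have hn0 : n ≠ 0 := by rintro rfl; exact hnd (dvd_zero _)
    obtain ⟨s, c, hc, rfl⟩ := Nat.exists_eq_pow_mul_and_not_dvd hn0 p hp.ne_one
    -- `s < N - m`
    have hs : s < N - m := by
      by_contra hs
      exact hnd (dvd_mul_of_dvd_left (pow_dvd_pow p (not_lt.mp hs)) c)
    have hNs : N = s + (N - s) := by omega
    -- divide by `p ^ s` up to torsion
    have h1 : p ^ s • (c • x - p ^ (N - s) • R) = T := by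
      rw [smul_sub, smul_smul, ← mul_smul, ← pow_add, ← hNs, hn, add_sub_cancel_left]
    have hT' : IsOfFinAddOrder (c • x - p ^ (N - s) • R) :=
      IsOfFinAddOrder.of_nsmul (h1 ▸ hT : IsOfFinAddOrder (p ^ s • _)) (pow_ne_zero s hp.ne_zero)
    -- Bézout for `(c, p ^ (N - s)) = 1`
    have hcop : IsCoprime (c : ℤ) ((p ^ (N - s) : ℕ) : ℤ) := by
      rw [Int.isCoprime_iff_gcd_eq_one, Int.gcd_natCast_natCast]
      exact ((Nat.Prime.coprime_iff_not_dvd hp).mpr hc).symm.pow_right (N - s)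
    obtain ⟨u, w, huw⟩ := hcop
    apply hm1
    refine ⟨p ^ (N - s - (m + 1)) • (u • R + w • x), u • (c • x - p ^ (N - s) • R), hT'.zsmul, ?_⟩
    have hNs' : N - s = (m + 1) + (N - s - (m + 1)) := by omega
    have key : x = u • (c • x - p ^ (N - s) • R) + p ^ (N - s) • (u • R + w • x) := by
      have h2 : x = (u * (c : ℤ) + w * ((p ^ (N - s) : ℕ) : ℤ)) • x := by rw [huw, one_smul]
      conv_lhs => rw [h2]
      rw [add_smul, mul_smul, mul_smul, natCast_zsmul, natCast_zsmul, smul_sub, smul_add,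
        smul_comm u (p ^ (N - s)) R, smul_comm w (p ^ (N - s)) x]
      abel
    conv_lhs => rw [key]
    rw [smul_smul (p ^ (m + 1)), ← pow_add, ← hNs', add_comm]
  · rintro ⟨b, rfl⟩
    rcases le_or_gt m N with hmN | hNm
    · refine ⟨b • R₀, (p ^ (N - m) * b) • T₀, hT₀.nsmul, ?_⟩
      conv_lhs => rw [hx]
      rw [smul_add, smul_smul, show p ^ (N - m) * b * p ^ m = p ^ N * b by
        rw [mul_right_comm, pow_sub_mul_pow p hmN], mul_smul]
    · have h0 : N - m = 0 := by omega
      rw [h0, pow_zero, one_mul]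
      refine ⟨b • p ^ (m - N) • R₀, b • T₀, hT₀.nsmul, ?_⟩
      conv_lhs => rw [hx]
      rw [smul_add, smul_comm (p ^ N) b, smul_smul (p ^ N) (p ^ (m - N)) R₀,
        ← pow_add, Nat.add_sub_cancel' hNm.le]

/-- Integer-multiplier form of `exists_eq_pow_smul_add_torsion_nsmul_iff`:
`a • x ∈ p^N • G + G_tors ⟺ p^(N-m) ∣ a` for `a : ℤ`. [folklore] -/
theorem exists_eq_pow_smul_add_torsion_zsmul_iff {p : ℕ} (hp : p.Prime) {x : G} {m : ℕ}
    (hm : ∃ R T : G, IsOfFinAddOrder T ∧ x = p ^ m • R + T)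
    (hm1 : ¬ ∃ R T : G, IsOfFinAddOrder T ∧ x = p ^ (m + 1) • R + T) (N : ℕ) (a : ℤ) :
    (∃ R T : G, IsOfFinAddOrder T ∧ a • x = p ^ N • R + T) ↔ (p : ℤ) ^ (N - m) ∣ a := by
  set n : ℕ := a.natAbs with hn
  have key := exists_eq_pow_smul_add_torsion_nsmul_iff hp hm hm1 N n
  have hdvd : (p : ℤ) ^ (N - m) ∣ a ↔ p ^ (N - m) ∣ n := by
    rw [← Int.natCast_pow, Int.natCast_dvd]
  rw [hdvd, ← key]
  rcases Int.natAbs_eq a with ha | ha <;> rw [← hn] at ha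
  · rw [ha]
    simp only [natCast_zsmul]
  · constructor
    · rintro ⟨R, T, hT, h⟩
      refine ⟨-R, -T, hT.neg, ?_⟩
      rw [smul_neg, ← neg_add, ← h, ha, neg_smul, natCast_zsmul, neg_neg]
    · rintro ⟨R, T, hT, h⟩
      refine ⟨-R, -T, hT.neg, ?_⟩
      rw [smul_neg, ← neg_add, ← h, ha, neg_smul, natCast_zsmul]

end DivisibilityLevel

section Torsion

variable {G : Type*} [AddCommGroup G]

/-- A non-zero integer multiple of a point of infinite order has infinite order. [folklore] -/
theorem isOfFinAddOrder_of_zsmul {c : ℤ} (hc : c ≠ 0) {x : G} (h : IsOfFinAddOrder (c • x)) :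
    IsOfFinAddOrder x := by
  rcases Int.natAbs_eq c with hc' | hc'
  · rw [hc', natCast_zsmul] at h
    exact h.of_nsmul (Int.natAbs_ne_zero.mpr hc)
  · rw [hc', neg_smul, natCast_zsmul] at h
    exact h.of_neg.of_nsmul (Int.natAbs_ne_zero.mpr hc)

/-- `p^N ∣ p^m·a ⟺ p^(N-m) ∣ a` in `ℤ` (for `p ≠ 0`). [folklore] -/
theorem pow_dvd_pow_mul_iff_pow_sub_dvd {p : ℤ} (hp : p ≠ 0) (N m : ℕ) (a : ℤ) :
    p ^ N ∣ p ^ m * a ↔ p ^ (N - m) ∣ a := by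
  rcases le_or_gt N m with h | h
  · rw [Nat.sub_eq_zero_of_le h, pow_zero]
    exact ⟨fun _ => one_dvd a, fun _ => dvd_mul_of_dvd_left (pow_dvd_pow p h) a⟩
  · conv_lhs => rw [show N = m + (N - m) by omega, pow_add]
    exact mul_dvd_mul_iff_left (pow_ne_zero m hp)

end Torsion

/-! ### §2 The `p^m`-torsion of `ℚ_p/ℤ_p` -/

section Prufer

variable (p : ℕ) [hp : Fact p.Prime]

/-- `b • e_N = 0` in `ℚ_p/ℤ_p` iff `p^N ∣ b` (`e_N = [p^{-N}]`). [folklore] -/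
theorem zsmul_prufGen_eq_zero_iff (N : ℕ) (b : ℤ) :
    b • prufGen p N = 0 ↔ (p : ℤ) ^ N ∣ b := by
  have hp0 : (p : ℚ_[p]) ≠ 0 := Nat.cast_ne_zero.mpr hp.out.ne_zero
  have hrepr : b • prufGen p N =
      ((((b : ℚ_[p]) / (p : ℚ_[p]) ^ N + ((0 : ℤ_[p]) : ℚ_[p]) : ℚ_[p])) : PruferQuot p) := by
    rw [PruferQuot.mk_int_div_pow_add]
    rfl
  rw [hrepr, QuotientAddGroup.eq_zero_iff, PadicInt.coe_zero, add_zero]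
  constructor
  · intro h
    exact_mod_cast Padic.pow_dvd_of_int_div_pow_mem p N b h
  · rintro ⟨c, rfl⟩
    have : (((p : ℤ) ^ N * c : ℤ) : ℚ_[p]) / (p : ℚ_[p]) ^ N = ((c : ℤ_[p]) : ℚ_[p]) := by
      push_cast
      rw [mul_div_cancel_left₀ _ (pow_ne_zero _ hp0)]
    rw [this]
    exact (c : ℤ_[p]).2

/-- **`#(ℚ_p/ℤ_p)[p^m] = p^m`**: the `p^m`-torsion of `ℚ_p/ℤ_p` is `ℤ·e_m ≅ ℤ/p^m`. [folklore] -/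
theorem natCard_torsionBy_pruferQuot_pow (m : ℕ) :
    Nat.card ↥((PruferQuot p)[((p ^ m : ℕ) : ℤ)]) = p ^ m := by
  let f : ℤ →+ PruferQuot p := zmultiplesHom (PruferQuot p) (prufGen p m)
  have hf : ∀ b : ℤ, f b = b • prufGen p m := fun b => rfl
  have hrange : f.range = (PruferQuot p)[((p ^ m : ℕ) : ℤ)] := by
    ext x
    rw [AddSubgroup.torsionBy.nsmul_iff]
    constructor
    · rintro ⟨b, rfl⟩
      rw [hf, smul_comm, ← natCast_zsmul, zsmul_prufGen_self, smul_zero]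
    · intro hx
      obtain ⟨N, a, rfl⟩ := exists_eq_zsmul_prufGen p x
      rw [← natCast_zsmul, smul_smul, zsmul_prufGen_eq_zero_iff] at hx
      rcases le_or_gt N m with hNm | hmN
      · refine ⟨a * (p ^ (m - N) : ℕ), ?_⟩
        rw [hf, mul_smul, ← zsmul_prufGen_add p N (m - N), Nat.add_sub_cancel' hNm]
      · have hsplit : ((p ^ m : ℕ) : ℤ) * a = (p : ℤ) ^ m * a := by push_cast; ring
        rw [hsplit, show N = m + (N - m) by omega, pow_add] at hx
        obtain ⟨c, hc⟩ := (mul_dvd_mul_iff_left (pow_ne_zero m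
          (Int.natCast_ne_zero.mpr hp.out.ne_zero))).mp hx
        refine ⟨c, ?_⟩
        rw [hf, hc, mul_comm, mul_smul, ← Int.natCast_pow, ← zsmul_prufGen_add p m (N - m),
          show m + (N - m) = N by omega]
  have hker : f.ker = AddSubgroup.zmultiples ((p ^ m : ℕ) : ℤ) := by
    ext b
    rw [AddMonoidHom.mem_ker, hf, zsmul_prufGen_eq_zero_iff, Int.mem_zmultiples_iff,
      Int.natCast_pow]
  rw [← hrange, Nat.card_congr (QuotientAddGroup.quotientKerEquivRange f).symm.toEquiv,
    Nat.card_congr (QuotientAddGroup.quotientAddEquivOfEq hker).toEquiv,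
    Nat.card_congr (Int.quotientZMultiplesNatEquivZMod (p ^ m)).toEquiv, Nat.card_zmod]

end Prufer

/-! ### §3 The «uniserial» lemma -/

section Uniserial

variable {L : Type*} [AddCommGroup L]

/-- **A `p`-primary abelian group with at most `p` elements killed by `p` has no proper non-zero
`p`-divisible subgroup.** (Its `p`-torsion is then cyclic of order `p`, generated by any non-zero
`p`-torsion element of the divisible subgroup `R`; induction on the exponent: if `p^{k+1} y = 0` then
`p y ∈ R`, `p y = p z` with `z ∈ R`, and `y - z` is `p`-torsion, hence in `R`.) [folklore] -/
theorem eq_top_of_divisible_of_card_torsion_le {p : ℕ} (hp : p.Prime)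
    (hprim : ∀ y : L, ∃ n : ℕ, p ^ n • y = 0)
    (hcard : ∀ S : Finset L, (∀ y ∈ S, p • y = 0) → S.card ≤ p)
    (R : AddSubgroup L) (hdiv : ∀ y ∈ R, ∃ z ∈ R, p • z = y) (hR : R ≠ ⊥) : R = ⊤ := by
  haveI : Fact p.Prime := ⟨hp⟩
  -- a non-zero `p`-torsion element of `R`
  obtain ⟨z, hzR, hz0, hpz⟩ : ∃ z ∈ R, z ≠ 0 ∧ p • z = 0 := by
    obtain ⟨⟨y, hyR⟩, hy0⟩ := AddSubgroup.ne_bot_iff_exists_ne_zero.mp hR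
    have hy0' : y ≠ 0 := fun h => hy0 (Subtype.ext h)
    have hex : ∃ n : ℕ, p ^ n • y = 0 := hprim y
    let n := Nat.find hex
    have hn : p ^ n • y = 0 := Nat.find_spec hex
    have hn0 : n ≠ 0 := by
      intro h
      rw [h, pow_zero, one_smul] at hn
      exact hy0' hn
    refine ⟨p ^ (n - 1) • y, R.nsmul_mem hyR _, ?_, ?_⟩
    · exact Nat.find_min hex (Nat.sub_one_lt hn0)
    · rw [smul_smul, ← pow_succ', Nat.sub_one_add_one hn0, hn]
  -- the `p`-torsion is `ℤ·z ≤ R`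
  have hZle : AddSubgroup.zmultiples z ≤ R := AddSubgroup.zmultiples_le.mpr hzR
  have hord : addOrderOf z = p := addOrderOf_eq_prime hpz hz0
  have htors : ∀ y : L, p • y = 0 → y ∈ AddSubgroup.zmultiples z := by
    intro y hy
    by_contra hyz
    -- the `p + 1` elements `y, 0•z, …, (p-1)•z` are distinct and killed by `p`
    have hzfin : IsOfFinAddOrder z := addOrderOf_pos_iff.mp (hord ▸ hp.pos)
    haveI : Finite (AddSubgroup.zmultiples z) := hzfin.finite_zmultiples.to_subtype
    haveI : Fintype (AddSubgroup.zmultiples z) := Fintype.ofFinite _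
    let S : Finset L :=
      insert y ((Finset.univ : Finset (AddSubgroup.zmultiples z)).map
        ⟨Subtype.val, Subtype.val_injective⟩)
    have hS : ∀ w ∈ S, p • w = 0 := by
      intro w hw
      rcases Finset.mem_insert.mp hw with rfl | hw
      · exact hy
      · obtain ⟨⟨w', hw'⟩, -, rfl⟩ := Finset.mem_map.mp hw
        obtain ⟨k, rfl⟩ := AddSubgroup.mem_zmultiples_iff.mp hw'
        change p • k • z = 0
        rw [smul_comm, hpz, smul_zero]
    have hcardS : S.card = p + 1 := by
      rw [Finset.card_insert_of_notMem, Finset.card_map, Finset.card_univ,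
        ← Nat.card_eq_fintype_card, Nat.card_zmultiples, hord]
      intro hmem
      obtain ⟨⟨w', hw'⟩, -, hw⟩ := Finset.mem_map.mp hmem
      exact hyz (hw ▸ hw')
    have := hcard S hS
    omega
  -- induction on the exponent
  have hind : ∀ k : ℕ, ∀ y : L, p ^ k • y = 0 → y ∈ R := by
    intro k
    induction k with
    | zero =>
      intro y hy
      rw [pow_zero, one_smul] at hy
      rw [hy]
      exact R.zero_mem
    | succ k ih =>
      intro y hy
      rw [pow_succ, mul_smul] at hy
      obtain ⟨w, hwR, hw⟩ := hdiv (p • y) (ih _ hy)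
      have hyw : y - w ∈ R := hZle (htors (y - w) (by rw [smul_sub, hw, sub_self]))
      have : y = (y - w) + w := by abel
      rw [this]
      exact R.add_mem hyw hwR
  rw [eq_top_iff]
  intro y _
  obtain ⟨n, hn⟩ := hprim y
  exact hind n y hn

end Uniserial

end Summit.BirchSwinnertonDyer.Rank1Residual.Ordinary

end
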